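import Mathlib.LinearAlgebra.Matrix.Permanent
import Mathlib.RingTheory.MvPolynomial.Basic
import Mathlib.LinearAlgebra.LinearIndependent.Defs
import Mathlib.Tactic
import Literature.Computability.AlgebraicComplexity.StandardFamilies
import Summits.ValiantsHypothesis.ValiantsHypothesis.Theorems.RyserTripartitionPerLeTripartitionAlgebra
import HarnessLib

/-!
# Sub-permanents of the generic matrix: substitution of partial permutation matrices and linear independence

Bookkeeping for the flattening (partial-derivative) rank bound of `Theorems/RowPartitionRank.lean`,
over any commutative (semi)ring:
* `minorPer P J = Σ_{b : P ≃ J} ∏_{p ∈ P} x_{p, b p}` — the rectangular sub-permanent of the generic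
  `n × n` matrix on rows `P`, columns `J` (`minorPer_univ : minorPer univ univ = per_n`);
* `rowSubst r c : x_{r,j} ↦ [j = c]` and `matchSubst K M : x_{i,j} ↦ [j = M i]` (`i ∈ K`), algebra
  endomorphisms; `matchSubst_minorPer`: for `K ⊆ P`, `M` injective on `K`, `M(K) ⊆ J`,
  `matchSubst K M (minorPer P J) = minorPer (P ∖ K) (J ∖ M(K))` (row expansion
  `RyserTripartition.sum_equiv_prod_eq_sum_erase`, one row at a time); `matchSubst_perPoly`;
* `linearIndependent_minorPer`: the family `(P, J) ↦ minorPer P J` over `|P| = |J| = a` is linearly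
  independent — the 0/1 point on the graph of a bijection `b₀ : P ≃ J` (`graphPt`) evaluates
  `minorPer P J` to `1` (`eval_graphPt_self`) and every other member to `0` (`eval_graphPt_other`).

HONEST FRAMING: elementary identities about the generic permanent; nothing here bears on
`VP ≠ VNP`, which is NOT proved.

## References
* [Ryser1963] H. J. Ryser, *Combinatorial Mathematics*, Carus Monograph 14, MAA 1963, Ch. 2 §5
  (sub-permanents, row expansion).
* [NisanWigderson1996] N. Nisan, A. Wigderson, *Lower bounds on arithmetic circuits via partial
  derivatives*, Comput. Complexity 6 (1996/97) 217–234, §3 (restrictions of the permanent to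
  complementary minors).
-/

-- layout Summits/ValiantsHypothesis/ValiantsHypothesis forces the duplicated namespace component
set_option linter.dupNamespace false

namespace Summit.ValiantsHypothesis.ValiantsHypothesis.Theorems.GenericSubpermanents

open Finset MvPolynomial Literature.Computability.AlgebraicComplexity
open Summit.ValiantsHypothesis.ValiantsHypothesis.Theorems.RyserTripartition

noncomputable section

variable {R : Type*} [CommSemiring R]


/-! ### Rectangular sub-permanents of the generic matrix -/

/-- The rectangular sub-permanent of the generic `n × n` matrix on the row set `P` and the column set
`J`: `Σ_{b : P ≃ J} ∏_{p ∈ P} X_{p, b p}` (zero unless `|P| = |J|`). [cite: Ryser1963, Ch. 2 §5] -/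
def minorPer (R : Type*) [CommSemiring R] (n : ℕ) (P J : Finset (Fin n)) :
    MvPolynomial (Fin n × Fin n) R :=
  ∑ b : ↥P ≃ ↥J, ∏ p : ↥P, X ((p : Fin n), ((b p : ↥J) : Fin n))

/-- The full sub-permanent is the generic permanent `per_n`. [cite: Ryser1963, Ch. 2 §5] -/
theorem minorPer_univ (n : ℕ) :
    minorPer R n (univ : Finset (Fin n)) (univ : Finset (Fin n)) = perPoly (Fin n) R := by
  classical
  let e : ↥(univ : Finset (Fin n)) ≃ Fin n := Equiv.subtypeUnivEquiv mem_univ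
  unfold minorPer Literature.Computability.AlgebraicComplexity.perPoly
  rw [← Matrix.permanent_transpose]
  unfold Matrix.permanent
  refine Fintype.sum_equiv (Equiv.equivCongr e e) _ _ (fun b => ?_)
  refine Fintype.prod_equiv e _ _ (fun p => ?_)
  simp [Matrix.transpose_apply, Matrix.mvPolynomialX_apply, Equiv.equivCongr_apply_apply, e]

/-! ### Substituting a 0/1 unit vector for one row -/

/-- The substitution `x_{r,j} ↦ [j = c]` on the row `r` (all other variables unchanged), as an
algebra endomorphism of the polynomial ring. [cite: NisanWigderson1996, §3] -/
def rowSubst (n : ℕ) (r c : Fin n) :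
    MvPolynomial (Fin n × Fin n) R →ₐ[R] MvPolynomial (Fin n × Fin n) R :=
  aeval fun ij : Fin n × Fin n => if ij.1 = r then (if ij.2 = c then 1 else 0) else X ij

/-- The single-row substitution on variables. [folklore] -/
@[simp] theorem rowSubst_X (n : ℕ) (r c : Fin n) (ij : Fin n × Fin n) :
    rowSubst (R := R) n r c (X ij) = if ij.1 = r then (if ij.2 = c then 1 else 0) else X ij := by
  simp [rowSubst]

/-- The substitution on row `r` fixes every sub-permanent not using the row `r`. [folklore] -/
theorem rowSubst_minorPer_of_not_mem (n : ℕ) (r c : Fin n) {P : Finset (Fin n)} (J : Finset (Fin n))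
    (hr : r ∉ P) : rowSubst (R := R) n r c (minorPer R n P J) = minorPer R n P J := by
  unfold minorPer
  rw [map_sum]
  refine sum_congr rfl fun b _ => ?_
  rw [map_prod]
  refine prod_congr rfl fun p _ => ?_
  have hp : (p : Fin n) ≠ r := fun h => hr (h ▸ p.2)
  simp [hp]

/-- **Substituting the unit vector `e_c` for the row `r ∈ P` (`c ∈ J`) turns the sub-permanent on
`P × J` into the one on `(P ∖ r) × (J ∖ c)`** (row expansion along `r`). [folklore] -/
theorem rowSubst_minorPer (n : ℕ) {r c : Fin n} {P J : Finset (Fin n)} (hr : r ∈ P) (hc : c ∈ J) :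
    rowSubst (R := R) n r c (minorPer R n P J) = minorPer R n (P.erase r) (J.erase c) := by
  classical
  unfold minorPer
  rw [sum_equiv_prod_eq_sum_erase (fun i j : Fin n => (X (i, j) : MvPolynomial (Fin n × Fin n) R))
    P J hr, map_sum]
  have hfix : ∀ c' : Fin n, rowSubst (R := R) n r c
      (∑ b : ↥(P.erase r) ≃ ↥(J.erase c'), ∏ p : ↥(P.erase r), X ((p : Fin n), ((b p : ↥(J.erase c')) : Fin n)))
      = ∑ b : ↥(P.erase r) ≃ ↥(J.erase c'), ∏ p : ↥(P.erase r), X ((p : Fin n), ((b p : ↥(J.erase c')) : Fin n)) :=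
    fun c' => rowSubst_minorPer_of_not_mem (R := R) n r c (J.erase c') (P := P.erase r)
      (Finset.notMem_erase r P)
  simp_rw [map_mul, rowSubst_X]
  simp only [↓reduceIte]
  have key : ∀ c' ∈ J, (if c' = c then (1 : MvPolynomial (Fin n × Fin n) R) else 0) *
      rowSubst (R := R) n r c (∑ b : ↥(P.erase r) ≃ ↥(J.erase c'),
        ∏ p : ↥(P.erase r), X ((p : Fin n), ((b p : ↥(J.erase c')) : Fin n)))
      = if c' = c then ∑ b : ↥(P.erase r) ≃ ↥(J.erase c),
        ∏ p : ↥(P.erase r), X ((p : Fin n), ((b p : ↥(J.erase c)) : Fin n)) else 0 := by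
    intro c' _
    split_ifs with h
    · subst h; rw [one_mul]; exact hfix c'
    · rw [zero_mul]
  rw [sum_congr rfl key, sum_ite_eq' J c, if_pos hc]

/-! ### Substituting a partial permutation matrix for a set of rows -/

/-- The substitution `x_{i,j} ↦ [j = M i]` on every row `i ∈ K` (other rows unchanged).
[cite: NisanWigderson1996, §3] -/
def matchSubst (n : ℕ) (K : Finset (Fin n)) (M : Fin n → Fin n) :
    MvPolynomial (Fin n × Fin n) R →ₐ[R] MvPolynomial (Fin n × Fin n) R :=
  aeval fun ij : Fin n × Fin n => if ij.1 ∈ K then (if ij.2 = M ij.1 then 1 else 0) else X ij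

/-- The matching substitution on variables. [folklore] -/
@[simp] theorem matchSubst_X (n : ℕ) (K : Finset (Fin n)) (M : Fin n → Fin n) (ij : Fin n × Fin n) :
    matchSubst (R := R) n K M (X ij) =
      if ij.1 ∈ K then (if ij.2 = M ij.1 then 1 else 0) else X ij := by
  simp [matchSubst]

/-- Substituting on no row is the identity. [folklore] -/
theorem matchSubst_empty (n : ℕ) (M : Fin n → Fin n) :
    matchSubst (R := R) n ∅ M = AlgHom.id R _ := by
  refine MvPolynomial.algHom_ext fun ij => ?_
  simp

/-- Adding a row to the substituted set = one more single-row substitution. [folklore] -/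
theorem matchSubst_insert (n : ℕ) {K : Finset (Fin n)} {r : Fin n} (hr : r ∉ K) (M : Fin n → Fin n) :
    matchSubst (R := R) n (insert r K) M = (rowSubst n r (M r)).comp (matchSubst n K M) := by
  classical
  refine MvPolynomial.algHom_ext fun ij => ?_
  obtain ⟨i, j⟩ := ij
  rw [AlgHom.comp_apply, matchSubst_X, matchSubst_X]
  by_cases hi : i = r
  · subst hi
    simp [hr]
  · by_cases hiK : i ∈ K
    · simp only [hiK, mem_insert, hi, false_or, ↓reduceIte]
      split_ifs <;> simp
    · simp [hi, hiK]

/-- **Substituting a partial permutation matrix.** For `K ⊆ P` and `M` injective on `K` with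
`M(K) ⊆ J`: substituting `e_{M i}` for every row `i ∈ K` turns the sub-permanent on `P × J` into the
one on `(P ∖ K) × (J ∖ M(K))`. [cite: NisanWigderson1996, §3] -/
theorem matchSubst_minorPer (n : ℕ) (K : Finset (Fin n)) (M : Fin n → Fin n)
    (hM : Set.InjOn M (K : Set (Fin n))) {P J : Finset (Fin n)} (hKP : K ⊆ P)
    (hMJ : ∀ i ∈ K, M i ∈ J) :
    matchSubst (R := R) n K M (minorPer R n P J) = minorPer R n (P \ K) (J \ K.image M) := by
  classical
  induction K using Finset.induction_on with
  | empty => simp [matchSubst_empty]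
  | @insert r K hrK ih =>
    have hKP' : K ⊆ P := fun i hi => hKP (mem_insert_of_mem hi)
    have hMJ' : ∀ i ∈ K, M i ∈ J := fun i hi => hMJ i (mem_insert_of_mem hi)
    have hM' : Set.InjOn M (K : Set (Fin n)) := hM.mono (by simp)
    rw [matchSubst_insert (R := R) n hrK M, AlgHom.comp_apply, ih hM' hKP' hMJ']
    have hr : r ∈ P \ K := mem_sdiff.mpr ⟨hKP (mem_insert_self r K), hrK⟩
    have hc : M r ∈ J \ K.image M := by
      refine mem_sdiff.mpr ⟨hMJ r (mem_insert_self r K), fun h => ?_⟩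
      obtain ⟨i, hiK, hi⟩ := mem_image.mp h
      have : i = r := hM (by simp [hiK]) (by simp) hi
      exact hrK (this ▸ hiK)
    rw [rowSubst_minorPer (R := R) n hr hc, image_insert, Finset.sdiff_insert, Finset.sdiff_insert]

/-- The case `P = J = univ`: substituting a partial permutation matrix on the rows `K` into `per_n`
gives the sub-permanent on the complementary rows and columns. [cite: NisanWigderson1996, §3] -/
theorem matchSubst_perPoly (n : ℕ) (K : Finset (Fin n)) (M : Fin n → Fin n)
    (hM : Set.InjOn M (K : Set (Fin n))) :
    matchSubst (R := R) n K M (perPoly (Fin n) R) = minorPer R n (univ \ K) (univ \ K.image M) := by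
  rw [← minorPer_univ, matchSubst_minorPer (R := R) n K M hM (subset_univ K) (fun i _ => mem_univ _)]

/-! ### Separating the sub-permanents by 0/1 points: linear independence -/

/-- The 0/1 point supported on the graph of a bijection `b₀ : P ≃ J`. [folklore] -/
def graphPt (n : ℕ) {P J : Finset (Fin n)} (b₀ : ↥P ≃ ↥J) : Fin n × Fin n → R :=
  fun ij => if h : ij.1 ∈ P then (if ((b₀ ⟨ij.1, h⟩ : ↥J) : Fin n) = ij.2 then 1 else 0) else 0

/-- At the graph point of `b₀ : P ≃ J` the sub-permanent on `P × J` evaluates to `1`. [folklore] -/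
theorem eval_graphPt_self (n : ℕ) {P J : Finset (Fin n)} (b₀ : ↥P ≃ ↥J) :
    eval (graphPt (R := R) n b₀) (minorPer R n P J) = 1 := by
  classical
  unfold minorPer
  rw [eval_sum, Finset.sum_eq_single b₀]
  · rw [eval_prod]
    refine prod_eq_one fun p _ => ?_
    simp [graphPt, p.2]
  · intro b _ hb
    rw [eval_prod]
    have : ∃ p : ↥P, b p ≠ b₀ p := by
      by_contra h
      push Not at h
      exact hb (Equiv.ext h)
    obtain ⟨p, hp⟩ := this
    refine prod_eq_zero (mem_univ p) ?_
    have hne : ((b₀ p : ↥J) : Fin n) ≠ ((b p : ↥J) : Fin n) :=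
      fun h => hp (Subtype.ext h).symm
    simp [graphPt, p.2, hne]
  · intro h; exact absurd (mem_univ b₀) h

/-- At the graph point of `b₀ : P ≃ J` every OTHER sub-permanent with `|P'| = |P|`, `|J'| = |J|`
vanishes. [folklore] -/
theorem eval_graphPt_other (n : ℕ) {P J P' J' : Finset (Fin n)} (b₀ : ↥P ≃ ↥J)
    (hP : P'.card = P.card) (hJ : J'.card = J.card) (hne : (P', J') ≠ (P, J)) :
    eval (graphPt (R := R) n b₀) (minorPer R n P' J') = 0 := by
  classical
  unfold minorPer
  rw [eval_sum]
  refine sum_eq_zero fun b _ => ?_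
  rw [eval_prod]
  by_cases hPP : P' = P
  · subst hPP
    have hJJ : J' ≠ J := fun h => hne (by rw [h])
    -- some `p` has `b p ≠ b₀ p` as columns, else `J ⊆ J'`
    have : ∃ p : ↥P', ((b₀ p : ↥J) : Fin n) ≠ ((b p : ↥J') : Fin n) := by
      by_contra h
      push Not at h
      apply hJJ
      symm
      refine eq_of_subset_of_card_le (fun j hj => ?_) hJ.le
      have := h (b₀.symm ⟨j, hj⟩)
      rw [Equiv.apply_symm_apply] at this
      rw [show j = ((b (b₀.symm ⟨j, hj⟩) : ↥J') : Fin n) from this]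
      exact (b _).2
    obtain ⟨p, hp⟩ := this
    refine prod_eq_zero (mem_univ p) ?_
    simp [graphPt, p.2, hp]
  · -- some row of `P'` lies outside `P`
    have : ∃ p ∈ P', p ∉ P := by
      by_contra h
      push Not at h
      exact hPP (eq_of_subset_of_card_le h hP.ge)
    obtain ⟨p, hpP', hpP⟩ := this
    refine prod_eq_zero (mem_univ ⟨p, hpP'⟩) ?_
    simp [graphPt, hpP]

section LinIndep

variable {F : Type*} [CommRing F]

/-- **The sub-permanents of a fixed format are linearly independent**: the family
`(P, J) ↦ minorPer P J` over `|P| = a`, `|J| = c` is linearly independent (each is separated from the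
others by the 0/1 point on the graph of one of its bijections; for `a ≠ c` all are `0`-free sums over
an empty type — we only use `a = c`). [folklore] -/
theorem linearIndependent_minorPer (n a : ℕ) :
    LinearIndependent F (fun PJ : {PJ : Finset (Fin n) × Finset (Fin n) // PJ.1.card = a ∧ PJ.2.card = a} =>
      minorPer F n PJ.1.1 PJ.1.2) := by
  classical
  rw [linearIndependent_iff']
  intro s g hg PJ hPJ
  obtain ⟨⟨P, J⟩, hP, hJ⟩ := PJ
  -- a bijection `P ≃ J` exists since `|P| = |J|`
  have hcard : Fintype.card ↥P = Fintype.card ↥J := by simp [hP, hJ]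
  let b₀ : ↥P ≃ ↥J := Fintype.equivOfCardEq hcard
  have h := congrArg (eval (graphPt (R := F) n b₀)) hg
  rw [eval_sum, map_zero] at h
  simp_rw [smul_eval] at h
  rw [Finset.sum_eq_single ⟨(P, J), hP, hJ⟩] at h
  · simpa [eval_graphPt_self] using h
  · rintro ⟨⟨P', J'⟩, hP', hJ'⟩ _ hne'
    have hne : (P', J') ≠ (P, J) := fun h => hne' (Subtype.ext h)
    rw [eval_graphPt_other (R := F) n b₀ (hP'.trans hP.symm) (hJ'.trans hJ.symm) hne, mul_zero]
  · intro h'; exact absurd hPJ h'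

end LinIndep

end

end Summit.ValiantsHypothesis.ValiantsHypothesis.Theorems.GenericSubpermanents
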